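import Literature.MathematicalPhysics.KineticTheory.HardSphereCanonicalKSLimit
import Literature.MathematicalPhysics.KineticTheory.HardSphereEulerLLN
import Literature.Analysis.FluidPDE.BBGKYMarginals
import Literature.Analysis.FluidPDE.MVRelativeEnergyPointwiseBounds
import HarnessLib

/-!
# (P-b2) · the windowed plateau from two-cluster factorisation (`stub_plateauWindow_of_factorisation`, here `plateauWindow_of_twoCluster_labelLaw`;
# crux line `liouville-continuity-pins-universal-contact-value`, `JParityClosure.EvenStressEnskog`, stmt-AtomisticToContinuum-13079)

The registered stub (P-b2): the canonical two-cluster factorisation at contact scale (P-a) and the density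
`v = vcan ε_N (N+1)` of the labelled two- and four-point laws of `P_N = posGibbsMeasure 1 ε_N (N+1)` (P-b1) imply the
WINDOWED PLATEAU — the relative decorrelation `|Cov| ≤ ζ vol(T) vol(T')`, `N ≥ N₀(σ, C, ζ)`, of two disjoint decorated dimers
`h(x_i) 𝟙_T(x_j − x_i)`, `h'(x_k) 𝟙_{T'}(x_l − x_k)` with displacement sets `T, T'` in the contact window `{d | d(d, 0) ≤ C ε_N}`.
Proof: by (P-b1) and Fubini along `(𝕋³)² × (𝕋³)² ≅ (𝕋³)⁴` (`appendMEquiv`) the covariance is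
`∫∫ f(a) f'(b) [v(a ++ b) − v(a) v(b)] da db`, `f(a) = h(a₀) 𝟙_T(a₁ − a₀)`; pointwise (`abs_dimerIntegrand_le`) the bracket is
`≤ δ 4⁴` by (P-a) when `d(a₀, b₀) ≥ M ε_N` (each dimer is a cluster of radius `< (C+1) ε_N` about its first point) and `≤ 32`
otherwise (`abs_vcan_le`); integrating the majorant by translation invariance of Haar measure (`abs_cov_prod_le`) gives
`vol T · vol T' · (δ 4⁴ + 32 v₁ (M ε_N)³)`, and `ε_N → 0`.  References: Ruelle, *Statistical Mechanics* (1969) §4.2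
[Ruelle1969]; Pulvirenti–Tsagkarogiannis, CMP 316 (2012) §5 [PulvirentiTsagkarogiannis2012].  Not here: (P-a), (P-b1)
themselves (hypotheses; tree `vcan_append_sub_mul_le`, `integral_labelLaw_eq_integral_mul_vcan`), the rung-0 closure (P-c).
(The elementary product bound `abs_mul_le_of_le` is reused from `MVRelativeEnergyPointwiseBounds`, hence that import.)
-/

noncomputable section

namespace Summit.AtomisticToContinuum.HydrodynamicLimit.Theorems.EvenStressEnskog

open Literature.Analysis.FluidPDE Literature.MathematicalPhysics.KineticTheory MeasureTheory Set
open Filter Topology CompressibleEuler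

/-! ### Haar-measure plumbing on `(𝕋³)²` -/

/-- Iterated integration on `(𝕋³)²` presented as `Fin 2 → 𝕋³` (Fubini along `finTwoArrow`). [folklore] -/
theorem integral_finTwo_eq_iterated (G : T3 → T3 → ℝ)
    (hG : Integrable (fun p : T3 × T3 => G p.1 p.2) ((volume : Measure T3).prod volume)) :
    ∫ a : Fin 2 → T3, G (a 0) (a 1) = ∫ x₀ : T3, ∫ x₁ : T3, G x₀ x₁ := by
  calc ∫ a : Fin 2 → T3, G (a 0) (a 1) = ∫ p : T3 × T3, G p.1 p.2 :=
        (volume_preserving_finTwoArrow T3).integral_comp' (fun p : T3 × T3 => G p.1 p.2)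
    _ = ∫ x₀, ∫ x₁, G x₀ x₁ := integral_prod (fun p : T3 × T3 => G p.1 p.2) hG

/-- `|𝟙_S| ≤ 1`. [folklore] -/
theorem abs_indicator_one_le_one (S : Set T3) (x : T3) : |S.indicator (fun _ => (1 : ℝ)) x| ≤ 1 := by
  by_cases hx : x ∈ S <;> simp [hx]

/-- `0 ≤ 𝟙_S`. [folklore] -/
theorem indicator_one_nonneg (S : Set T3) (x : T3) : 0 ≤ S.indicator (fun _ => (1 : ℝ)) x :=
  Set.indicator_nonneg (fun _ _ => zero_le_one) x

/-- The decorated dimer `f(z) = h(z₀) 𝟙_T(z₁ − z₀)` is measurable on `(𝕋³)²`. [folklore] -/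
theorem measurable_dimer {h : T3 → ℝ} (hh : Measurable h) {T : Set T3} (hT : MeasurableSet T) :
    Measurable fun z : Fin 2 → T3 => h (z 0) * T.indicator (fun _ => (1 : ℝ)) (z 1 - z 0) :=
  (hh.comp (measurable_pi_apply 0)).mul ((measurable_const.indicator hT).comp ((measurable_pi_apply 1).sub (measurable_pi_apply 0)))

/-- The decorated dimer is bounded by `1` when `|h| ≤ 1`. [folklore] -/
theorem abs_dimer_le_one {h : T3 → ℝ} (hb : ∀ y, |h y| ≤ 1) (T : Set T3) (z : Fin 2 → T3) :
    |h (z 0) * T.indicator (fun _ => (1 : ℝ)) (z 1 - z 0)| ≤ 1 := by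
  simpa using abs_mul_le_of_le (hb (z 0)) (abs_indicator_one_le_one T (z 1 - z 0))

/-- `∫_{(𝕋³)²} 𝟙_T(a₁ − a₀) da = vol T` (translation invariance of Haar measure, total mass `1`). [folklore] -/
theorem integral_indicator_sub_finTwo {T : Set T3} (hT : MeasurableSet T) :
    ∫ a : Fin 2 → T3, T.indicator (fun _ => (1 : ℝ)) (a 1 - a 0) = (volume T).toReal := by
  have hm : Measurable fun p : T3 × T3 => T.indicator (fun _ => (1 : ℝ)) (p.2 - p.1) :=
    (measurable_const.indicator hT).comp (measurable_snd.sub measurable_fst)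
  rw [integral_finTwo_eq_iterated (fun x₀ x₁ => T.indicator (fun _ => (1 : ℝ)) (x₁ - x₀))]
  · have h1 : ∀ x₀ : T3, ∫ x₁ : T3, T.indicator (fun _ => (1 : ℝ)) (x₁ - x₀) = (volume T).toReal := by
      intro x₀
      rw [integral_sub_right_eq_self (fun x => T.indicator (fun _ => (1 : ℝ)) x) x₀, integral_indicator_const _ hT, smul_eq_mul,
        mul_one, measureReal_def]
    simp [h1]
  · exact Integrable.of_bound hm.aestronglyMeasurable 1 (ae_of_all _ fun p => by
      simpa only [Real.norm_eq_abs] using abs_indicator_one_le_one T (p.2 - p.1))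

/-- `∫_{(𝕋³)²} 𝟙{d(b₀, a₀) < r} 𝟙_{T'}(b₁ − b₀) db = vol B(r) · vol T'` for `r < 1/2`, with `B(r)` the Euclidean ball
of `ℝ³` (translation invariance twice and `Torus.volume_euclidDist_lt`). [folklore] -/
theorem integral_ballIndicator_mul_indicator {T' : Set T3} (hT' : MeasurableSet T') {r : ℝ} (hr : r < 1 / 2) (a₀ : T3) :
    ∫ b : Fin 2 → T3, {x : T3 | Torus.euclidDist x a₀ < r}.indicator (fun _ => (1 : ℝ)) (b 0) * T'.indicator (fun _ => (1 : ℝ)) (b 1 - b 0)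
      = (volume (Metric.ball (0 : E3) r)).toReal * (volume T').toReal := by
  have hdist : Measurable fun x : T3 => Torus.euclidDist x a₀ := by
    change Measurable fun x : T3 => ‖Torus.reprSym (x - a₀)‖
    exact (Torus.measurable_reprSym.comp (measurable_id.sub_const a₀)).norm
  have hB : MeasurableSet {x : T3 | Torus.euclidDist x a₀ < r} := measurableSet_lt hdist measurable_const
  have hm : Measurable fun p : T3 × T3 =>
      {x : T3 | Torus.euclidDist x a₀ < r}.indicator (fun _ => (1 : ℝ)) p.1 * T'.indicator (fun _ => (1 : ℝ)) (p.2 - p.1) :=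
    ((measurable_const.indicator hB).comp measurable_fst).mul ((measurable_const.indicator hT').comp (measurable_snd.sub measurable_fst))
  rw [integral_finTwo_eq_iterated (fun x₀ x₁ => {x : T3 | Torus.euclidDist x a₀ < r}.indicator
    (fun _ => (1 : ℝ)) x₀ * T'.indicator (fun _ => (1 : ℝ)) (x₁ - x₀))]
  · have h1 : ∀ x₀ : T3, ∫ x₁ : T3, {x : T3 | Torus.euclidDist x a₀ < r}.indicator (fun _ => (1 : ℝ)) x₀ * T'.indicator (fun _ => (1 : ℝ)) (x₁ - x₀)
        = {x : T3 | Torus.euclidDist x a₀ < r}.indicator (fun _ => (1 : ℝ)) x₀ * (volume T').toReal := by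
      intro x₀
      rw [integral_const_mul, integral_sub_right_eq_self (fun x => T'.indicator (fun _ => (1 : ℝ)) x) x₀,
        integral_indicator_const _ hT', smul_eq_mul, mul_one, measureReal_def]
    simp_rw [h1]
    rw [integral_mul_const, integral_indicator_const _ hB, smul_eq_mul, mul_one, measureReal_def, Torus.volume_euclidDist_lt hr a₀]
  · exact Integrable.of_bound hm.aestronglyMeasurable (1 * 1) (ae_of_all _ fun p => by
      simpa only [Real.norm_eq_abs] using abs_mul_le_of_le (abs_indicator_one_le_one _ p.1) (abs_indicator_one_le_one T' (p.2 - p.1)))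

/-- The Lebesgue measure of a ball of `ℝ³`: `vol B(r) = v₁ r³`. [folklore] -/
theorem volume_real_ball_E3 {r : ℝ} (hr : 0 ≤ r) : (volume (Metric.ball (0 : E3) r)).toReal = v₁ * r ^ 3 := by
  rw [Measure.addHaar_ball volume (0 : E3) hr, finrank_euclideanSpace_fin, ENNReal.toReal_mul, ENNReal.toReal_ofReal (pow_nonneg hr 3), v₁, mul_comm]

/-! ### The pointwise estimate -/

/-- **Pointwise bound for the covariance integrand.**  For dimers `a, b : Fin 2 → 𝕋³`, marks `|h|, |h'| ≤ 1`,
`f(a) = h(a₀) 𝟙_T(a₁ − a₀)`, `f'(b) = h'(b₀) 𝟙_{T'}(b₁ − b₀)` with `T, T'` in the window `{d | d(d,0) ≤ C ε}`: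
`|f(a) f'(b) v(a ++ b) − f(a) v(a) f'(b) v(b)| ≤ 𝟙_T(a₁−a₀) 𝟙_{T'}(b₁−b₀) (δ 4⁴ + 32·𝟙{d(b₀,a₀) < Mε})` — far apart by
the two-cluster factorisation (each dimer is a cluster of radius `< (C+1)ε` about its first point), close together by
the a priori bound `v ≤ 2^k` (Ruelle 1969, §4.2.2 (2.15)). [folklore] -/
theorem abs_dimerIntegrand_le {σ : ℝ} (hsd : SmallDensity uniformProfile σ) {N : ℕ} {C M δ : ℝ} (hC : 0 ≤ C) (hδ : 0 ≤ δ)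
    (hAN : ∀ (k k' : ℕ) (Y : Fin k → T3) (Y' : Fin k' → T3) (c c' : T3),
        (∀ a, Torus.euclidDist (Y a) c < (C + 1) * hsDiameter σ N) →
        (∀ a, Torus.euclidDist (Y' a) c' < (C + 1) * hsDiameter σ N) →
        M * hsDiameter σ N ≤ Torus.euclidDist c c' →
        |vcan (hsDiameter σ N) (N + 1) (Fin.append Y Y') -
            vcan (hsDiameter σ N) (N + 1) Y * vcan (hsDiameter σ N) (N + 1) Y'| ≤ δ * 4 ^ (k + k'))
    {h h' : T3 → ℝ} (hb : ∀ y, |h y| ≤ 1) (hb' : ∀ y, |h' y| ≤ 1)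
    {T T' : Set T3} (hTW : T ⊆ {d | Torus.euclidDist d 0 ≤ C * hsDiameter σ N})
    (hT'W : T' ⊆ {d | Torus.euclidDist d 0 ≤ C * hsDiameter σ N}) (a b : Fin 2 → T3) :
    |h (a 0) * T.indicator (fun _ => (1 : ℝ)) (a 1 - a 0) * (h' (b 0) * T'.indicator (fun _ => (1 : ℝ)) (b 1 - b 0)) *
          vcan (hsDiameter σ N) (N + 1) (Fin.append a b) -
        h (a 0) * T.indicator (fun _ => (1 : ℝ)) (a 1 - a 0) * vcan (hsDiameter σ N) (N + 1) a *
          (h' (b 0) * T'.indicator (fun _ => (1 : ℝ)) (b 1 - b 0) * vcan (hsDiameter σ N) (N + 1) b)|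
      ≤ T.indicator (fun _ => (1 : ℝ)) (a 1 - a 0) * T'.indicator (fun _ => (1 : ℝ)) (b 1 - b 0) *
          (δ * 4 ^ (2 + 2) + 32 * {x : T3 | Torus.euclidDist x (a 0) < M * hsDiameter σ N}.indicator (fun _ => (1 : ℝ)) (b 0)) := by
  have hε : 0 < hsDiameter σ N := hsDiameter_pos hsd.σ_pos N
  rw [show h (a 0) * T.indicator (fun _ => (1 : ℝ)) (a 1 - a 0) * (h' (b 0) * T'.indicator (fun _ => (1 : ℝ)) (b 1 - b 0)) *
          vcan (hsDiameter σ N) (N + 1) (Fin.append a b) -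
        h (a 0) * T.indicator (fun _ => (1 : ℝ)) (a 1 - a 0) * vcan (hsDiameter σ N) (N + 1) a *
          (h' (b 0) * T'.indicator (fun _ => (1 : ℝ)) (b 1 - b 0) * vcan (hsDiameter σ N) (N + 1) b) =
      h (a 0) * T.indicator (fun _ => (1 : ℝ)) (a 1 - a 0) * (h' (b 0) * T'.indicator (fun _ => (1 : ℝ)) (b 1 - b 0)) *
        (vcan (hsDiameter σ N) (N + 1) (Fin.append a b) -
          vcan (hsDiameter σ N) (N + 1) a * vcan (hsDiameter σ N) (N + 1) b) by ring]
  -- a dimer whose displacement lies in the window is a cluster of radius `< (C+1)ε` about its first point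
  have hwin : ∀ (z : Fin 2 → T3) (S : Set T3), S ⊆ {d | Torus.euclidDist d 0 ≤ C * hsDiameter σ N} →
      z 1 - z 0 ∈ S → ∀ t, Torus.euclidDist (z t) (z 0) < (C + 1) * hsDiameter σ N := by
    intro z S hS hz
    have hCε : C * hsDiameter σ N < (C + 1) * hsDiameter σ N := by nlinarith
    refine Fin.forall_fin_two.2 ⟨?_, ?_⟩
    · rw [Torus.euclidDist_self]; positivity
    · have h1 := hS hz
      rw [mem_setOf_eq, Torus.euclidDist_eq, sub_zero] at h1
      rw [Torus.euclidDist_eq]; linarith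
  by_cases ha : a 1 - a 0 ∈ T
  · by_cases hbT : b 1 - b 0 ∈ T'
    · rw [indicator_of_mem ha, indicator_of_mem hbT]
      simp only [mul_one, one_mul]
      have hind := indicator_one_nonneg {x : T3 | Torus.euclidDist x (a 0) < M * hsDiameter σ N} (b 0)
      have hΔ : |vcan (hsDiameter σ N) (N + 1) (Fin.append a b) - vcan (hsDiameter σ N) (N + 1) a * vcan (hsDiameter σ N) (N + 1) b|
          ≤ δ * 4 ^ (2 + 2) + 32 * {x : T3 | Torus.euclidDist x (a 0) < M * hsDiameter σ N}.indicator (fun _ => (1 : ℝ)) (b 0) := by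
        by_cases hfar : M * hsDiameter σ N ≤ Torus.euclidDist (a 0) (b 0)
        · have h1 := hAN 2 2 a b (a 0) (b 0) (hwin a T hTW ha) (hwin b T' hT'W hbT) hfar
          nlinarith
        · have hnear : b 0 ∈ {x : T3 | Torus.euclidDist x (a 0) < M * hsDiameter σ N} := by
            rw [mem_setOf_eq, Torus.euclidDist_comm]; exact lt_of_not_ge hfar
          rw [indicator_of_mem hnear, mul_one]
          have h16 := abs_vcan_le hsd le_rfl (n := N + 1) (Fin.append a b)
          have h4a := abs_vcan_le hsd le_rfl (n := N + 1) a
          have h4b := abs_vcan_le hsd le_rfl (n := N + 1) b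
          have hδ4 : 0 ≤ δ * 4 ^ (2 + 2) := by positivity
          calc |vcan (hsDiameter σ N) (N + 1) (Fin.append a b) - vcan (hsDiameter σ N) (N + 1) a * vcan (hsDiameter σ N) (N + 1) b|
              ≤ |vcan (hsDiameter σ N) (N + 1) (Fin.append a b)| + |vcan (hsDiameter σ N) (N + 1) a * vcan (hsDiameter σ N) (N + 1) b| :=
                abs_sub _ _
            _ = |vcan (hsDiameter σ N) (N + 1) (Fin.append a b)| + |vcan (hsDiameter σ N) (N + 1) a| * |vcan (hsDiameter σ N) (N + 1) b| := by
                rw [abs_mul]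
            _ ≤ 2 ^ (2 + 2) + 2 ^ 2 * 2 ^ 2 := by gcongr
            _ ≤ δ * 4 ^ (2 + 2) + 32 := by norm_num; linarith
      calc |h (a 0) * h' (b 0) * (vcan (hsDiameter σ N) (N + 1) (Fin.append a b) - vcan (hsDiameter σ N) (N + 1) a * vcan (hsDiameter σ N) (N + 1) b)|
          = |h (a 0)| * |h' (b 0)| *
              |vcan (hsDiameter σ N) (N + 1) (Fin.append a b) - vcan (hsDiameter σ N) (N + 1) a * vcan (hsDiameter σ N) (N + 1) b| := by
            rw [abs_mul, abs_mul]
        _ ≤ 1 * 1 * (δ * 4 ^ (2 + 2) + 32 * {x : T3 | Torus.euclidDist x (a 0) < M * hsDiameter σ N}.indicator (fun _ => (1 : ℝ)) (b 0)) := by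
            gcongr; exacts [hb (a 0), hb' (b 0)]
        _ = _ := by ring
    · rw [indicator_of_notMem hbT]; simp
  · rw [indicator_of_notMem ha]; simp

/-! ### The covariance on the product space -/

/-- **The windowed covariance bound on `(𝕋³)² × (𝕋³)²`.**  With `f(a) = h(a₀)𝟙_T(a₁ − a₀)`, `f'(b) = h'(b₀)𝟙_{T'}(b₁ − b₀)`
(`|h|, |h'| ≤ 1`, `T, T'` in the window `{d | d(d,0) ≤ Cε_N}`) and `v = vcan ε_N (N+1)`:
`|∫∫ f f' v(a ++ b) − (∫ f v)(∫ f' v)| ≤ vol T · vol T' · (δ 4⁴ + 32 vol B(M ε_N))`, given the two-cluster factorisation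
at window `C + 1`, accuracy `δ`, separation `M` with `M ε_N < 1/2` (integrate the pointwise majorant of
`abs_dimerIntegrand_le` by translation invariance of Haar measure). [folklore] -/
theorem abs_cov_prod_le {σ : ℝ} (hsd : SmallDensity uniformProfile σ) {N : ℕ} {C M δ : ℝ} (hC : 0 ≤ C) (hδ : 0 ≤ δ)
    (hMε : M * hsDiameter σ N < 1 / 2)
    (hAN : ∀ (k k' : ℕ) (Y : Fin k → T3) (Y' : Fin k' → T3) (c c' : T3),
        (∀ a, Torus.euclidDist (Y a) c < (C + 1) * hsDiameter σ N) →
        (∀ a, Torus.euclidDist (Y' a) c' < (C + 1) * hsDiameter σ N) →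
        M * hsDiameter σ N ≤ Torus.euclidDist c c' →
        |vcan (hsDiameter σ N) (N + 1) (Fin.append Y Y') -
            vcan (hsDiameter σ N) (N + 1) Y * vcan (hsDiameter σ N) (N + 1) Y'| ≤ δ * 4 ^ (k + k'))
    {h h' : T3 → ℝ} (hh : Measurable h) (hh' : Measurable h') (hb : ∀ y, |h y| ≤ 1) (hb' : ∀ y, |h' y| ≤ 1)
    {T T' : Set T3} (hT : MeasurableSet T) (hT' : MeasurableSet T')
    (hTW : T ⊆ {d | Torus.euclidDist d 0 ≤ C * hsDiameter σ N}) (hT'W : T' ⊆ {d | Torus.euclidDist d 0 ≤ C * hsDiameter σ N}) :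
    |(∫ p : (Fin 2 → T3) × (Fin 2 → T3), h (p.1 0) * T.indicator (fun _ => (1 : ℝ)) (p.1 1 - p.1 0) *
          (h' (p.2 0) * T'.indicator (fun _ => (1 : ℝ)) (p.2 1 - p.2 0)) *
          vcan (hsDiameter σ N) (N + 1) (Fin.append p.1 p.2) ∂((volume : Measure (Fin 2 → T3)).prod volume)) -
      (∫ a : Fin 2 → T3, h (a 0) * T.indicator (fun _ => (1 : ℝ)) (a 1 - a 0) * vcan (hsDiameter σ N) (N + 1) a) *
      (∫ b : Fin 2 → T3, h' (b 0) * T'.indicator (fun _ => (1 : ℝ)) (b 1 - b 0) * vcan (hsDiameter σ N) (N + 1) b)|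
    ≤ (volume T).toReal * (volume T').toReal *
        (δ * 4 ^ (2 + 2) + 32 * (volume (Metric.ball (0 : E3) (M * hsDiameter σ N))).toReal) := by
  -- bounded measurable functions on the probability space `(𝕋³)² × (𝕋³)²` are integrable
  have hint : ∀ {g : (Fin 2 → T3) × (Fin 2 → T3) → ℝ}, Measurable g → ∀ K : ℝ, (∀ p, |g p| ≤ K) →
      Integrable g ((volume : Measure (Fin 2 → T3)).prod volume) := fun hg K hK =>
    Integrable.of_bound hg.aestronglyMeasurable K (ae_of_all _ fun p => by rw [Real.norm_eq_abs]; exact hK p)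
  -- measurability
  have hχm : Measurable fun z : Fin 2 → T3 => T.indicator (fun _ => (1 : ℝ)) (z 1 - z 0) :=
    (measurable_const.indicator hT).comp ((measurable_pi_apply 1).sub (measurable_pi_apply 0))
  have hχ'm : Measurable fun z : Fin 2 → T3 => T'.indicator (fun _ => (1 : ℝ)) (z 1 - z 0) :=
    (measurable_const.indicator hT').comp ((measurable_pi_apply 1).sub (measurable_pi_apply 0))
  have hfm := measurable_dimer hh hT
  have hf'm := measurable_dimer hh' hT'
  have hvm : Measurable fun z : Fin 2 → T3 => vcan (hsDiameter σ N) (N + 1) z := measurable_vcan_comp _ _ measurable_id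
  have happ : Measurable fun p : (Fin 2 → T3) × (Fin 2 → T3) => Fin.append p.1 p.2 := by
    rw [show (fun p : (Fin 2 → T3) × (Fin 2 → T3) => Fin.append p.1 p.2) = ⇑(appendMEquiv T3 2 2) from
      funext fun p => (appendMEquiv_apply p).symm]
    exact (appendMEquiv T3 2 2).measurable
  have hv4m : Measurable fun p : (Fin 2 → T3) × (Fin 2 → T3) => vcan (hsDiameter σ N) (N + 1) (Fin.append p.1 p.2) :=
    measurable_vcan_comp _ _ happ
  have h10 : Measurable fun p : (Fin 2 → T3) × (Fin 2 → T3) => p.1 0 := measurable_fst.eval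
  have h20 : Measurable fun p : (Fin 2 → T3) × (Fin 2 → T3) => p.2 0 := measurable_snd.eval
  have hnm : Measurable fun p : (Fin 2 → T3) × (Fin 2 → T3) =>
      {x : T3 | Torus.euclidDist x (p.1 0) < M * hsDiameter σ N}.indicator (fun _ => (1 : ℝ)) (p.2 0) := by
    have hd : Measurable fun p : (Fin 2 → T3) × (Fin 2 → T3) => Torus.euclidDist (p.2 0) (p.1 0) := by
      change Measurable fun p : (Fin 2 → T3) × (Fin 2 → T3) => ‖Torus.reprSym (p.2 0 - p.1 0)‖
      exact (Torus.measurable_reprSym.comp (h20.sub h10)).norm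
    change Measurable fun p : (Fin 2 → T3) × (Fin 2 → T3) =>
      if Torus.euclidDist (p.2 0) (p.1 0) < M * hsDiameter σ N then (1 : ℝ) else 0
    exact Measurable.ite (measurableSet_lt hd measurable_const) measurable_const measurable_const
  -- bounds
  have hχb : ∀ z : Fin 2 → T3, |T.indicator (fun _ => (1 : ℝ)) (z 1 - z 0)| ≤ 1 := fun z => abs_indicator_one_le_one T _
  have hχ'b : ∀ z : Fin 2 → T3, |T'.indicator (fun _ => (1 : ℝ)) (z 1 - z 0)| ≤ 1 := fun z => abs_indicator_one_le_one T' _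
  have hfb := abs_dimer_le_one hb T
  have hf'b := abs_dimer_le_one hb' T'
  have hvb : ∀ z : Fin 2 → T3, |vcan (hsDiameter σ N) (N + 1) z| ≤ 2 ^ 2 := fun z => abs_vcan_le hsd le_rfl z
  have hv4b : ∀ p : (Fin 2 → T3) × (Fin 2 → T3), |vcan (hsDiameter σ N) (N + 1) (Fin.append p.1 p.2)| ≤ 2 ^ (2 + 2) :=
    fun p => abs_vcan_le hsd le_rfl _
  have hnb : ∀ p : (Fin 2 → T3) × (Fin 2 → T3),
      |{x : T3 | Torus.euclidDist x (p.1 0) < M * hsDiameter σ N}.indicator (fun _ => (1 : ℝ)) (p.2 0)| ≤ 1 := fun p => abs_indicator_one_le_one _ _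
  -- integrability on the product space
  have hIa : Integrable (fun p : (Fin 2 → T3) × (Fin 2 → T3) =>
      h (p.1 0) * T.indicator (fun _ => (1 : ℝ)) (p.1 1 - p.1 0) * (h' (p.2 0) * T'.indicator (fun _ => (1 : ℝ)) (p.2 1 - p.2 0)) *
        vcan (hsDiameter σ N) (N + 1) (Fin.append p.1 p.2)) ((volume : Measure (Fin 2 → T3)).prod volume) :=
    hint (((hfm.comp measurable_fst).mul (hf'm.comp measurable_snd)).mul hv4m) (1 * 1 * 2 ^ (2 + 2)) fun p =>
      abs_mul_le_of_le (abs_mul_le_of_le (hfb p.1) (hf'b p.2)) (hv4b p)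
  have hIb : Integrable (fun p : (Fin 2 → T3) × (Fin 2 → T3) =>
      h (p.1 0) * T.indicator (fun _ => (1 : ℝ)) (p.1 1 - p.1 0) * vcan (hsDiameter σ N) (N + 1) p.1 *
        (h' (p.2 0) * T'.indicator (fun _ => (1 : ℝ)) (p.2 1 - p.2 0) * vcan (hsDiameter σ N) (N + 1) p.2))
      ((volume : Measure (Fin 2 → T3)).prod volume) :=
    hint (((hfm.mul hvm).comp measurable_fst).mul ((hf'm.mul hvm).comp measurable_snd)) (1 * 2 ^ 2 * (1 * 2 ^ 2)) fun p =>
      abs_mul_le_of_le (abs_mul_le_of_le (hfb p.1) (hvb p.1)) (abs_mul_le_of_le (hf'b p.2) (hvb p.2))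
  have hIc : Integrable (fun p : (Fin 2 → T3) × (Fin 2 → T3) =>
      T.indicator (fun _ => (1 : ℝ)) (p.1 1 - p.1 0) * T'.indicator (fun _ => (1 : ℝ)) (p.2 1 - p.2 0) *
        (δ * 4 ^ (2 + 2) + 32 * {x : T3 | Torus.euclidDist x (p.1 0) < M * hsDiameter σ N}.indicator (fun _ => (1 : ℝ)) (p.2 0)))
      ((volume : Measure (Fin 2 → T3)).prod volume) := by
    refine hint (((hχm.comp measurable_fst).mul (hχ'm.comp measurable_snd)).mul
      ((hnm.const_mul 32).const_add (δ * 4 ^ (2 + 2)))) (1 * 1 * (δ * 4 ^ (2 + 2) + 32)) fun p =>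
      abs_mul_le_of_le (abs_mul_le_of_le (hχb p.1) (hχ'b p.2)) ?_
    have h0 := indicator_one_nonneg {x : T3 | Torus.euclidDist x (p.1 0) < M * hsDiameter σ N} (p.2 0)
    have h1 := (abs_le.1 (hnb p)).2
    rw [abs_of_nonneg (by positivity)]; linarith
  have hId : Integrable (fun p : (Fin 2 → T3) × (Fin 2 → T3) =>
      T.indicator (fun _ => (1 : ℝ)) (p.1 1 - p.1 0) * T'.indicator (fun _ => (1 : ℝ)) (p.2 1 - p.2 0))
      ((volume : Measure (Fin 2 → T3)).prod volume) :=
    hint ((hχm.comp measurable_fst).mul (hχ'm.comp measurable_snd)) (1 * 1) fun p => abs_mul_le_of_le (hχb p.1) (hχ'b p.2)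
  have hIe : Integrable (fun p : (Fin 2 → T3) × (Fin 2 → T3) => T.indicator (fun _ => (1 : ℝ)) (p.1 1 - p.1 0) *
      ({x : T3 | Torus.euclidDist x (p.1 0) < M * hsDiameter σ N}.indicator (fun _ => (1 : ℝ)) (p.2 0) *
        T'.indicator (fun _ => (1 : ℝ)) (p.2 1 - p.2 0))) ((volume : Measure (Fin 2 → T3)).prod volume) :=
    hint ((hχm.comp measurable_fst).mul (hnm.mul (hχ'm.comp measurable_snd))) (1 * (1 * 1)) fun p =>
      abs_mul_le_of_le (hχb p.1) (abs_mul_le_of_le (hnb p) (hχ'b p.2))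
  -- the value of the majorant
  have hg : ∫ p : (Fin 2 → T3) × (Fin 2 → T3),
      T.indicator (fun _ => (1 : ℝ)) (p.1 1 - p.1 0) * T'.indicator (fun _ => (1 : ℝ)) (p.2 1 - p.2 0) *
        (δ * 4 ^ (2 + 2) + 32 * {x : T3 | Torus.euclidDist x (p.1 0) < M * hsDiameter σ N}.indicator (fun _ => (1 : ℝ)) (p.2 0))
        ∂((volume : Measure (Fin 2 → T3)).prod volume) =
      (volume T).toReal * (volume T').toReal *
        (δ * 4 ^ (2 + 2) + 32 * (volume (Metric.ball (0 : E3) (M * hsDiameter σ N))).toReal) := by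
    rw [show (fun p : (Fin 2 → T3) × (Fin 2 → T3) =>
        T.indicator (fun _ => (1 : ℝ)) (p.1 1 - p.1 0) * T'.indicator (fun _ => (1 : ℝ)) (p.2 1 - p.2 0) *
        (δ * 4 ^ (2 + 2) + 32 * {x : T3 | Torus.euclidDist x (p.1 0) < M * hsDiameter σ N}.indicator (fun _ => (1 : ℝ)) (p.2 0))) =
        fun p => δ * 4 ^ (2 + 2) * (T.indicator (fun _ => (1 : ℝ)) (p.1 1 - p.1 0) * T'.indicator (fun _ => (1 : ℝ)) (p.2 1 - p.2 0)) +
          32 * (T.indicator (fun _ => (1 : ℝ)) (p.1 1 - p.1 0) *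
            ({x : T3 | Torus.euclidDist x (p.1 0) < M * hsDiameter σ N}.indicator (fun _ => (1 : ℝ)) (p.2 0) *
              T'.indicator (fun _ => (1 : ℝ)) (p.2 1 - p.2 0))) from funext fun p => by ring,
      integral_add (hId.const_mul _) (hIe.const_mul _), integral_const_mul, integral_const_mul,
      integral_prod_mul (μ := volume) (ν := volume) (fun a : Fin 2 → T3 => T.indicator (fun _ => (1 : ℝ)) (a 1 - a 0))
        (fun b : Fin 2 → T3 => T'.indicator (fun _ => (1 : ℝ)) (b 1 - b 0)),
      integral_indicator_sub_finTwo hT, integral_indicator_sub_finTwo hT', integral_prod _ hIe]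
    have inner : ∀ a : Fin 2 → T3, ∫ b : Fin 2 → T3, T.indicator (fun _ => (1 : ℝ)) (a 1 - a 0) *
        ({x : T3 | Torus.euclidDist x (a 0) < M * hsDiameter σ N}.indicator (fun _ => (1 : ℝ)) (b 0) *
          T'.indicator (fun _ => (1 : ℝ)) (b 1 - b 0)) = T.indicator (fun _ => (1 : ℝ)) (a 1 - a 0) *
          ((volume (Metric.ball (0 : E3) (M * hsDiameter σ N))).toReal * (volume T').toReal) := fun a => by
      rw [integral_const_mul, integral_ballIndicator_mul_indicator hT' hMε (a 0)]
    simp only [inner]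
    rw [integral_mul_const, integral_indicator_sub_finTwo hT]; ring
  -- assemble
  rw [← integral_prod_mul (μ := volume) (ν := volume)
      (fun a : Fin 2 → T3 => h (a 0) * T.indicator (fun _ => (1 : ℝ)) (a 1 - a 0) * vcan (hsDiameter σ N) (N + 1) a)
      (fun b : Fin 2 → T3 => h' (b 0) * T'.indicator (fun _ => (1 : ℝ)) (b 1 - b 0) * vcan (hsDiameter σ N) (N + 1) b),
    ← integral_sub hIa hIb, ← Real.norm_eq_abs, ← hg]
  exact norm_integral_le_of_norm_le hIc (ae_of_all _ fun p => by
    rw [Real.norm_eq_abs]; exact abs_dimerIntegrand_le hsd hC hδ hAN hb hb' hTW hT'W p.1 p.2)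

/-! ### The registered stub -/

/-- **(P-b2) The windowed plateau from two-cluster factorisation** (the registered stub `stub_plateauWindow_of_factorisation`
of the line `liouville-continuity-pins-universal-contact-value`, `Stubs.stub_twoClusterFactorisation → Stubs.stub_labelLawDensity →
PlateauWindow`, with the three skeleton `Prop`s unfolded verbatim; registered under this name with the unfolded text): the
canonical two-cluster factorisation at contact scale and the density `vcan` of the labelled two- and four-point laws of
`posGibbsMeasure 1 ε_N (N+1)` imply the relative decorrelation `|Cov| ≤ ζ vol(T) vol(T')` of two disjoint decorated
dimers with displacement sets in the contact window `{d | d(d,0) ≤ C ε_N}`, for `N ≥ N₀(σ, C, ζ)`. [folklore] -/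
theorem plateauWindow_of_twoCluster_labelLaw :
    (∀ σ : ℝ, SmallDensity uniformProfile σ → ∀ L : ℝ, 0 < L → ∀ δ : ℝ, 0 < δ →
      ∃ M : ℝ, 0 < M ∧ ∃ N₀ : ℕ, ∀ N : ℕ, N₀ ≤ N →
      ∀ (k k' : ℕ) (Y : Fin k → T3) (Y' : Fin k' → T3) (c c' : T3),
        (∀ a, Torus.euclidDist (Y a) c < L * hsDiameter σ N) →
        (∀ a, Torus.euclidDist (Y' a) c' < L * hsDiameter σ N) →
        M * hsDiameter σ N ≤ Torus.euclidDist c c' →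
        |vcan (hsDiameter σ N) (N + 1) (Fin.append Y Y') -
            vcan (hsDiameter σ N) (N + 1) Y * vcan (hsDiameter σ N) (N + 1) Y'| ≤ δ * 4 ^ (k + k')) →
    (∀ σ : ℝ, SmallDensity uniformProfile σ → ∀ (N : ℕ),
      (∀ (i j : Fin (N + 1)), i ≠ j → ∀ F : (Fin 2 → T3) → ℝ, Measurable F → (∃ C : ℝ, ∀ y, |F y| ≤ C) →
        ∫ x, F ![x i, x j] ∂posGibbsMeasure (fun _ : T3 => (1 : ℝ)) (hsDiameter σ N) (N + 1) =
          ∫ y : Fin 2 → T3, F y * vcan (hsDiameter σ N) (N + 1) y) ∧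
      (∀ (i j k l : Fin (N + 1)), i ≠ j → i ≠ k → i ≠ l → j ≠ k → j ≠ l → k ≠ l →
        ∀ F : (Fin 4 → T3) → ℝ, Measurable F → (∃ C : ℝ, ∀ y, |F y| ≤ C) →
        ∫ x, F ![x i, x j, x k, x l] ∂posGibbsMeasure (fun _ : T3 => (1 : ℝ)) (hsDiameter σ N) (N + 1) =
          ∫ y : Fin 4 → T3, F y * vcan (hsDiameter σ N) (N + 1) y)) →
    ∃ σ₁ : ℝ, 0 < σ₁ ∧ ∀ σ : ℝ, 0 < σ → σ < σ₁ → ∀ C : ℝ, 1 ≤ C → ∀ ζ : ℝ, 0 < ζ → ∃ N₀ : ℕ, ∀ N : ℕ, N₀ ≤ N →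
      ∀ i j k l : Fin (N + 1), i ≠ j → i ≠ k → i ≠ l → j ≠ k → j ≠ l → k ≠ l →
      ∀ (h h' : T3 → ℝ), Measurable h → Measurable h' → (∀ y, |h y| ≤ 1) → (∀ y, |h' y| ≤ 1) →
      ∀ T T' : Set T3, MeasurableSet T → MeasurableSet T' →
      T ⊆ {d | Torus.euclidDist d 0 ≤ C * hsDiameter σ N} → T' ⊆ {d | Torus.euclidDist d 0 ≤ C * hsDiameter σ N} →
      |(∫ x, h (x i) * T.indicator (fun _ => (1 : ℝ)) (x j - x i) * (h' (x k) * T'.indicator (fun _ => (1 : ℝ)) (x l - x k))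
          ∂posGibbsMeasure (fun _ : T3 => (1 : ℝ)) (hsDiameter σ N) (N + 1)) -
        (∫ x, h (x i) * T.indicator (fun _ => (1 : ℝ)) (x j - x i)
          ∂posGibbsMeasure (fun _ : T3 => (1 : ℝ)) (hsDiameter σ N) (N + 1)) *
        (∫ x, h' (x k) * T'.indicator (fun _ => (1 : ℝ)) (x l - x k)
          ∂posGibbsMeasure (fun _ : T3 => (1 : ℝ)) (hsDiameter σ N) (N + 1))|
        ≤ ζ * (volume T).toReal * (volume T').toReal := by
  intro hA hB
  obtain ⟨σ₀, hσ₀, hsmall⟩ := exists_smallDensity uniformProfile one_pos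
  refine ⟨σ₀, hσ₀, fun σ hσ hσ₁ C hC ζ hζ => ?_⟩
  have hsd : SmallDensity uniformProfile σ := (hsmall σ hσ hσ₁).1
  obtain ⟨M, hM, NA, hNA⟩ := hA σ hsd (C + 1) (by linarith) (ζ / (2 * 4 ^ (2 + 2))) (by positivity)
  -- the near region `{d(b₀, a₀) < M ε_N}` has vanishing volume `v₁ (M ε_N)³`
  have h1 : Tendsto (fun N : ℕ => M * hsDiameter σ N) atTop (𝓝 0) := by simpa using (tendsto_hsDiameter σ).const_mul M
  have h2 : Tendsto (fun N : ℕ => v₁ * (M * hsDiameter σ N) ^ 3) atTop (𝓝 0) := by simpa using (h1.pow 3).const_mul v₁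
  obtain ⟨NB, hNB⟩ := eventually_atTop.1 ((h1.eventually (Iio_mem_nhds (by norm_num : (0 : ℝ) < 1 / 2))).and
    (h2.eventually (Iio_mem_nhds (by positivity : (0 : ℝ) < ζ / 64))))
  refine ⟨max NA NB, fun N hN => ?_⟩
  intro i j k l hij hik hil hjk hjl hkl h h' hh hh' hb hb' T T' hT hT' hTW hT'W
  have hAN := hNA N ((le_max_left _ _).trans hN)
  obtain ⟨hMε, hvol⟩ := hNB N ((le_max_right _ _).trans hN)
  obtain ⟨hB2, hB4⟩ := hB σ hsd N
  have hF4m : Measurable fun y : Fin 4 → T3 => h (y 0) * T.indicator (fun _ => (1 : ℝ)) (y 1 - y 0) *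
      (h' (y 2) * T'.indicator (fun _ => (1 : ℝ)) (y 3 - y 2)) :=
    ((hh.comp (measurable_pi_apply 0)).mul ((measurable_const.indicator hT).comp ((measurable_pi_apply 1).sub (measurable_pi_apply 0)))).mul
      ((hh'.comp (measurable_pi_apply 2)).mul ((measurable_const.indicator hT').comp ((measurable_pi_apply 3).sub (measurable_pi_apply 2))))
  have hF4b : ∀ y : Fin 4 → T3, |h (y 0) * T.indicator (fun _ => (1 : ℝ)) (y 1 - y 0) *
      (h' (y 2) * T'.indicator (fun _ => (1 : ℝ)) (y 3 - y 2))| ≤ 1 := fun y => by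
    simpa using abs_mul_le_of_le (abs_mul_le_of_le (hb (y 0)) (abs_indicator_one_le_one T (y 1 - y 0)))
      (abs_mul_le_of_le (hb' (y 2)) (abs_indicator_one_le_one T' (y 3 - y 2)))
  -- (P-b1): the three expectations as Haar integrals against `vcan`
  have e4 : ∫ x, h (x i) * T.indicator (fun _ => (1 : ℝ)) (x j - x i) * (h' (x k) * T'.indicator (fun _ => (1 : ℝ)) (x l - x k))
        ∂posGibbsMeasure (fun _ : T3 => (1 : ℝ)) (hsDiameter σ N) (N + 1) =
      ∫ y : Fin 4 → T3, h (y 0) * T.indicator (fun _ => (1 : ℝ)) (y 1 - y 0) *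
        (h' (y 2) * T'.indicator (fun _ => (1 : ℝ)) (y 3 - y 2)) * vcan (hsDiameter σ N) (N + 1) y :=
    hB4 i j k l hij hik hil hjk hjl hkl _ hF4m ⟨1, hF4b⟩
  have e2 : ∫ x, h (x i) * T.indicator (fun _ => (1 : ℝ)) (x j - x i) ∂posGibbsMeasure (fun _ : T3 => (1 : ℝ)) (hsDiameter σ N) (N + 1) =
      ∫ y : Fin 2 → T3, h (y 0) * T.indicator (fun _ => (1 : ℝ)) (y 1 - y 0) * vcan (hsDiameter σ N) (N + 1) y :=
    hB2 i j hij _ (measurable_dimer hh hT) ⟨1, abs_dimer_le_one hb T⟩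
  have e2' : ∫ x, h' (x k) * T'.indicator (fun _ => (1 : ℝ)) (x l - x k) ∂posGibbsMeasure (fun _ : T3 => (1 : ℝ)) (hsDiameter σ N) (N + 1) =
      ∫ y : Fin 2 → T3, h' (y 0) * T'.indicator (fun _ => (1 : ℝ)) (y 1 - y 0) * vcan (hsDiameter σ N) (N + 1) y :=
    hB2 k l hkl _ (measurable_dimer hh' hT') ⟨1, abs_dimer_le_one hb' T'⟩
  -- the four-point integral along the juxtaposition `(𝕋³)² × (𝕋³)² ≅ (𝕋³)⁴`
  have e5 : ∫ y : Fin 4 → T3, h (y 0) * T.indicator (fun _ => (1 : ℝ)) (y 1 - y 0) *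
        (h' (y 2) * T'.indicator (fun _ => (1 : ℝ)) (y 3 - y 2)) * vcan (hsDiameter σ N) (N + 1) y =
      ∫ p : (Fin 2 → T3) × (Fin 2 → T3), h (p.1 0) * T.indicator (fun _ => (1 : ℝ)) (p.1 1 - p.1 0) *
        (h' (p.2 0) * T'.indicator (fun _ => (1 : ℝ)) (p.2 1 - p.2 0)) *
        vcan (hsDiameter σ N) (N + 1) (Fin.append p.1 p.2) ∂((volume : Measure (Fin 2 → T3)).prod volume) := by
    rw [← (volume_preserving_appendMEquiv T3 2 2).integral_comp']
    exact integral_congr_ae (ae_of_all _ fun p => by simp only [appendMEquiv_apply]; rfl)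
  rw [e4, e2, e2', e5]
  refine (abs_cov_prod_le hsd (by linarith) (by positivity) hMε hAN hh hh' hb hb' hT hT' hTW hT'W).trans ?_
  rw [volume_real_ball_E3 (mul_nonneg hM.le (hsDiameter_pos hσ N).le)]
  have hTT : 0 ≤ (volume T).toReal * (volume T').toReal := by positivity
  have hnum : ζ / (2 * 4 ^ (2 + 2)) * 4 ^ (2 + 2) + 32 * (v₁ * (M * hsDiameter σ N) ^ 3) ≤ ζ := by
    rw [show ζ / (2 * 4 ^ (2 + 2)) * 4 ^ (2 + 2) = ζ / 2 by ring]; linarith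
  calc (volume T).toReal * (volume T').toReal * (ζ / (2 * 4 ^ (2 + 2)) * 4 ^ (2 + 2) + 32 * (v₁ * (M * hsDiameter σ N) ^ 3))
      ≤ (volume T).toReal * (volume T').toReal * ζ := mul_le_mul_of_nonneg_left hnum hTT
    _ = ζ * (volume T).toReal * (volume T').toReal := by ring

end Summit.AtomisticToContinuum.HydrodynamicLimit.Theorems.EvenStressEnskog
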